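/-
Copyright (c) 2026 the pub-hodgecm-mathlib formalisation cell (harness21).  Prover seat hodgecm-mathlib-K2Liu-p07 (g2): Track B «K2-LIT»,
#184♮ = hLiu418 = stmt-HodgeConjecture-24832; LEAD F0P6-plan (g10) DEAL∕SWAP 2026-09-03T23:05:23Z «O41.4» (organ of socket #41
`sig_K2LiuSiegelEisensteinContinuation`); REPORT-FIRST O41.4 `K2/K2Liu-p07/g2/REPORT-FIRST-O41_4-ConstantTermDelta.K2Liup07g2.md` 99eb0f16d8bad5ea,
file (a); 2026-09-03.
-/
import Literature.NumberTheory.K2Lit.SiegelDoubledUnipotent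
import HarnessLib

/-!
# Crux `HLiu418`, road `K2_Liu`, organ O41.4 file (a): the big Bruhat cell `P_Δ w_Δ P_Δ = P_Δ w_Δ N_Δ` is FREE —
# `w_Δ u w_Δ ∈ P_Δ(𝔸)` with `u ∈ N_Δ(𝔸)` forces `u = 1`, and `w_Δ ∉ P_Δ(𝔸)`

Cell `hodgecm-mathlib`, crux item hLiu418 = `stmt-HodgeConjecture-24832`, route `HCCMUnconditional`; squad K2 ∕ K2Liu, LEAD F0P6-plan (g10),
planner K2Liu-plan (g0), #41 steward lineage K2Liu-p01, prover K2Liu-p07 (g2).  THEOREMS ONLY (no `def`, no instance, no notation, no named-fact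
hypothesis, no `sorry`); lane `--supports stmt-HodgeConjecture-24832` (count-neutral helper).  Import: ★ D9 `K2Lit/SiegelDoubledUnipotent` only.

WHAT IS PROVED (block algebra over ★ D9's carriers `unipDelta`, `weylDelta`, ★ `blk`, ★ `IsSiegelDelta`; `X := (blk u)₁₂` the corner of `u`):
* §1 `blk_eq_of_mem_unipDelta`: for `u ∈ N_Δ(𝔸)`, `blk u = (1 − X, X; −X, 1 + X)` (from D9's frame `E₁·blk u·E₂ = (1 X; 0 1)` and ★ `conjE_eq`);
  `blk (w_Δ u w_Δ) = (1 − X, −X; X, 1 + X)` (★ `blk_weylDelta = diag(1, −1)`).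
* §2 **`eq_one_of_mem_unipDelta_of_isSiegelDelta_conj`**: `u ∈ N_Δ(𝔸)`, `w_Δ u w_Δ ∈ P_Δ(𝔸)` ⇒ `u = 1` — the Siegel condition on
  `(1 − X, −X; X, 1 + X)` reads `(1 − X) − X = X + (1 + X)`, i.e. `4X = 0`, and `4` is a unit of the `L`-algebra `𝔸_L`.  Equivalently
  (`w_Δ⁻¹ = w_Δ`, ★ `weylDelta_inv`) **`w_Δ N_Δ(𝔸) w_Δ⁻¹ ∩ P_Δ(𝔸) = 1`**: the stabiliser of the coset `P_Δ w_Δ` under right multiplication by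
  `N_Δ` is trivial, so `P_Δ(L⁺)\P_Δ(L⁺) w_Δ N_Δ(L⁺) ≅ N_Δ(L⁺)` freely — the reason the `w_Δ`-cell of the constant term of the Siegel Eisenstein
  series unfolds to the FULL intertwining integral `∫_{N_Δ(𝔸)} f(w_Δ u h) du = M(s)f(h)` (O41.4), and the input O41.3 (K2Liu-p06) names as
  «Bruhat-injectivity».
* §3 **`not_isSiegelDelta_weylDelta`** (`0 < n`): `w_Δ ∉ P_Δ(𝔸)` (`diag(1,−1)` would need `1 = −1` on `Δ`, `2 ≠ 0` in `𝔸_L`); hence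
  `not_isSiegelDelta_weylDelta_mul` : `w_Δ u ∉ P_Δ(𝔸)` for `u ∈ N_Δ(𝔸)` — the `w_Δ`-orbit and the identity orbit of `P_Δ(L⁺)\H(L⁺)` are distinct.
[MoeglinWaldspurger1995, II.1.7 (constant terms along `P`: the cell `w` with `w⁻¹Pw ∩ N`)], [GelbartPiatetskishapiroRallis1987, Part A §1 (the big
cell of `P\H/P` for the doubled group)], [KudlaRallis1994, §2], [Tan1999, §2].
HONEST LABEL.  Count-neutral helper; `HC_CM` is proved only modulo the 7 printed citations (2 remaining named inputs: hLiu418 =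
`stmt-HodgeConjecture-24832`, h413 = `stmt-HodgeConjecture-24833`) until rung 0 closes.
-/

set_option autoImplicit false
set_option linter.dupNamespace false -- the mandated namespace repeats `HodgeConjecture.HodgeConjecture`

noncomputable section

open scoped Matrix
open NumberField IsDedekindDomain
open Literature.NumberTheory.GelbartRogawski1991 Literature.NumberTheory.GelbartRogawski1991.GRConstruction
open Literature.NumberTheory.K2Lit.SiegelDoubled

namespace Summit.HodgeConjecture.HodgeConjecture.Cruxes.HLiu418.K2LiuSiegelBigCellFree

variable (L : Type) [Field L] [NumberField L] [IsCMField L]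
variable {N M n : ℕ} (e : Fin N × Fin M ≃ Fin n)
  (dV : Fin N → L) (hdV : ∀ i, IsCMField.complexConj L (dV i) = dV i)
  (dW : Fin M → L) (hdW : ∀ i, IsCMField.complexConj L (dW i) = dW i)

/-! ## §1 The block matrices of `u ∈ N_Δ(𝔸)` and of `w_Δ u w_Δ` -/

/-- **`blk u = (1 − X, X; −X, 1 + X)`** for `u ∈ N_Δ(𝔸)`, `X = (blk u)₁₂`: D9's frame `E₁·blk u·E₂ = (1 X; 0 1)` (★ `mem_unipDelta_iff_conj`) read
through ★ `conjE_eq` block by block. [cite: MoeglinWaldspurger1995, I.2.1] [cite: GelbartPiatetskishapiroRallis1987, Part A §1] -/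
theorem blk_eq_of_mem_unipDelta {u : HA L e dV hdV dW hdW} (hu : u ∈ unipDelta L e dV hdV dW hdW) :
    blk L e dV hdV dW hdW u =
      Matrix.fromBlocks (1 - (blk L e dV hdV dW hdW u).toBlocks₁₂) (blk L e dV hdV dW hdW u).toBlocks₁₂
        (-(blk L e dV hdV dW hdW u).toBlocks₁₂) (1 + (blk L e dV hdV dW hdW u).toBlocks₁₂) := by
  set B := blk L e dV hdV dW hdW u with hB
  have h := (mem_unipDelta_iff_conj L e dV hdV dW hdW u).1 hu
  rw [conjE_eq, Matrix.fromBlocks_inj] at h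
  obtain ⟨h11, -, h21, h22⟩ := h
  -- `B₁₁ + B₁₂ = 1`, `B₂₁ + B₂₂ − (B₁₁ + B₁₂) = 0`, `B₂₂ − B₁₂ = 1`
  have e11 : B.toBlocks₁₁ = 1 - B.toBlocks₁₂ := eq_sub_of_add_eq h11
  have e22 : B.toBlocks₂₂ = 1 + B.toBlocks₁₂ := by rw [← h22]; abel
  have e21 : B.toBlocks₂₁ = -B.toBlocks₁₂ := by
    rw [h11, e22] at h21
    have h0 : B.toBlocks₂₁ + (1 + B.toBlocks₁₂) - 1 = 0 := h21
    rw [← sub_eq_zero, ← h0]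
    abel
  conv_lhs => rw [← Matrix.fromBlocks_toBlocks B]
  rw [e11, e21, e22]

/-- **`blk (w_Δ u w_Δ) = (1 − X, −X; X, 1 + X)`** (`blk w_Δ = diag(1, −1)` ★ `blk_weylDelta`, ★ `blk_mul`). [cite: GelbartPiatetskishapiroRallis1987, Part A §1] -/
theorem blk_weylDelta_mul_mul_weylDelta {u : HA L e dV hdV dW hdW} (hu : u ∈ unipDelta L e dV hdV dW hdW) :
    blk L e dV hdV dW hdW (weylDelta L e dV hdV dW hdW * u * weylDelta L e dV hdV dW hdW) =
      Matrix.fromBlocks (1 - (blk L e dV hdV dW hdW u).toBlocks₁₂) (-(blk L e dV hdV dW hdW u).toBlocks₁₂)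
        (blk L e dV hdV dW hdW u).toBlocks₁₂ (1 + (blk L e dV hdV dW hdW u).toBlocks₁₂) := by
  rw [blk_mul, blk_mul, blk_weylDelta, blk_eq_of_mem_unipDelta L e dV hdV dW hdW hu, Matrix.fromBlocks_multiply,
    Matrix.fromBlocks_multiply]
  simp only [Matrix.one_mul, Matrix.mul_one, Matrix.zero_mul, Matrix.mul_zero, add_zero, zero_add, Matrix.neg_mul,
    Matrix.mul_neg, neg_neg, neg_zero, Matrix.toBlocks_fromBlocks₁₂]

/-! ## §2 The big cell is free: `w_Δ u w_Δ ∈ P_Δ(𝔸)`, `u ∈ N_Δ(𝔸)` ⇒ `u = 1` -/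

omit [IsCMField L] in
/-- `4` is a unit of `𝔸_L` (an `L`-algebra), so `4 • X = 0` forces `X = 0` for adelic matrices. [folklore] -/
theorem eq_zero_of_four_nsmul_eq_zero {X : Matrix (Fin n) (Fin n) (AdeleRing (𝓞 L) L)} (h : (4 : ℕ) • X = 0) : X = 0 := by
  have h4 : ((4 : ℕ) : L) ≠ 0 := by norm_num
  have key : ((4 : ℕ) : L)⁻¹ • (((4 : ℕ) : L) • X) = X := by rw [smul_smul, inv_mul_cancel₀ h4, one_smul]
  rw [← key, Nat.cast_smul_eq_nsmul, h, smul_zero]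

/-- **THE BIG CELL IS FREE**: if `u ∈ N_Δ(𝔸)` and `w_Δ u w_Δ ∈ P_Δ(𝔸)` then `u = 1`.  In blocks, the Siegel condition (★ `IsSiegelDelta`:
`B₁₁ + B₁₂ = B₂₁ + B₂₂`) on `(1 − X, −X; X, 1 + X)` is `1 − 2X = 1 + 2X`, i.e. `4X = 0`, so `X = 0`, `blk u = 1`, `u = 1` (★ `eq_of_blk_eq`).
[cite: MoeglinWaldspurger1995, II.1.7] [cite: GelbartPiatetskishapiroRallis1987, Part A §1] [cite: Tan1999, §2] -/
theorem eq_one_of_mem_unipDelta_of_isSiegelDelta_conj {u : HA L e dV hdV dW hdW} (hu : u ∈ unipDelta L e dV hdV dW hdW)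
    (hP : IsSiegelDelta L e dV hdV dW hdW (weylDelta L e dV hdV dW hdW * u * weylDelta L e dV hdV dW hdW)) : u = 1 := by
  set X := (blk L e dV hdV dW hdW u).toBlocks₁₂ with hX
  -- the Siegel condition on `blk (w u w)`
  have hS : (1 - X) + (-X) = X + (1 + X) := by
    have h := hP
    unfold IsSiegelDelta at h
    rwa [blk_weylDelta_mul_mul_weylDelta L e dV hdV dW hdW hu, Matrix.toBlocks_fromBlocks₁₁, Matrix.toBlocks_fromBlocks₁₂,
      Matrix.toBlocks_fromBlocks₂₁, Matrix.toBlocks_fromBlocks₂₂] at h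
  have h0 : (1 - X + -X) - (X + (1 + X)) = 0 := sub_eq_zero.mpr hS
  have h' : X + X + X + X = 0 := by
    rw [← neg_eq_zero, ← h0]
    abel
  have h4 : (4 : ℕ) • X = 0 := by
    rw [show (4 : ℕ) • X = X + X + X + X by abel]
    exact h'
  have hX0 : X = 0 := eq_zero_of_four_nsmul_eq_zero L h4
  -- hence `blk u = 1 = blk 1`
  have hblk : blk L e dV hdV dW hdW u = blk L e dV hdV dW hdW 1 := by
    have h1 : blk L e dV hdV dW hdW (1 : HA L e dV hdV dW hdW) = 1 := by
      simp only [blk, Matrix.reindex_apply, Subgroup.coe_one, Units.val_one, Matrix.submatrix_one_equiv]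
    rw [blk_eq_of_mem_unipDelta L e dV hdV dW hdW hu, ← hX, hX0, h1, sub_zero, neg_zero, add_zero, Matrix.fromBlocks_one]
  exact eq_of_blk_eq L e dV hdV dW hdW hblk

/-- The same with `w_Δ⁻¹` on the right (`w_Δ⁻¹ = w_Δ`, ★ `weylDelta_inv`): **`w_Δ N_Δ(𝔸) w_Δ⁻¹ ∩ P_Δ(𝔸) = 1`** — the stabiliser of the coset
`P_Δ w_Δ` under right multiplication by `N_Δ` is trivial («Bruhat-injectivity» for O41.3∕O41.4). [cite: MoeglinWaldspurger1995, II.1.7] -/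
theorem eq_one_of_mem_unipDelta_of_isSiegelDelta_conj_inv {u : HA L e dV hdV dW hdW} (hu : u ∈ unipDelta L e dV hdV dW hdW)
    (hP : IsSiegelDelta L e dV hdV dW hdW (weylDelta L e dV hdV dW hdW * u * (weylDelta L e dV hdV dW hdW)⁻¹)) : u = 1 := by
  rw [weylDelta_inv] at hP
  exact eq_one_of_mem_unipDelta_of_isSiegelDelta_conj L e dV hdV dW hdW hu hP

/-- **Injectivity of `ν ↦ P_Δ(𝔸) w_Δ ν` on `N_Δ(𝔸)`**: if `p · w_Δ ν = w_Δ ν'` with `p ∈ P_Δ(𝔸)` and `ν, ν' ∈ N_Δ(𝔸)`, then `ν = ν'` (apply the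
freeness to `u = ν' ν⁻¹`: `w_Δ u w_Δ⁻¹ = p⁻¹ ∈ P_Δ(𝔸)`... precisely `w_Δ ν' ν⁻¹ w_Δ⁻¹ = p`). [cite: MoeglinWaldspurger1995, II.1.7] -/
theorem eq_of_isSiegelDelta_weylDelta_mul {p ν ν' : HA L e dV hdV dW hdW} (hp : IsSiegelDelta L e dV hdV dW hdW p)
    (hν : ν ∈ unipDelta L e dV hdV dW hdW) (hν' : ν' ∈ unipDelta L e dV hdV dW hdW)
    (h : p * (weylDelta L e dV hdV dW hdW * ν) = weylDelta L e dV hdV dW hdW * ν') : ν = ν' := by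
  have hu : ν' * ν⁻¹ ∈ unipDelta L e dV hdV dW hdW := mul_mem hν' (inv_mem hν)
  have hconj : weylDelta L e dV hdV dW hdW * (ν' * ν⁻¹) * (weylDelta L e dV hdV dW hdW)⁻¹ = p := by
    have hpe : p = weylDelta L e dV hdV dW hdW * ν' * (weylDelta L e dV hdV dW hdW * ν)⁻¹ := eq_mul_inv_of_mul_eq h
    rw [hpe, mul_inv_rev]
    simp only [mul_assoc]
  have h1 : ν' * ν⁻¹ = 1 :=
    eq_one_of_mem_unipDelta_of_isSiegelDelta_conj_inv L e dV hdV dW hdW hu (by rw [hconj]; exact hp)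
  exact (mul_inv_eq_one.1 h1).symm

/-! ## §3 `w_Δ ∉ P_Δ(𝔸)` (`n ≠ 0`): the `w_Δ`-orbit is not the identity orbit -/

/-- **`w_Δ ∉ P_Δ(𝔸)` for `0 < n`**: `blk w_Δ = diag(1, −1)` is Siegel iff `1 = −1` on `Δ`, i.e. `2 = 0` in the `n × n` adelic matrices, which fails
at the `(0,0)` entry since `𝔸_L ⊇ L` has characteristic `0`. [cite: GelbartPiatetskishapiroRallis1987, Part A §1] [cite: Tan1999, §2] -/
theorem not_isSiegelDelta_weylDelta (hn : 0 < n) : ¬ IsSiegelDelta L e dV hdV dW hdW (weylDelta L e dV hdV dW hdW) := by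
  intro h
  unfold IsSiegelDelta at h
  rw [blk_weylDelta, Matrix.toBlocks_fromBlocks₁₁, Matrix.toBlocks_fromBlocks₁₂, Matrix.toBlocks_fromBlocks₂₁,
    Matrix.toBlocks_fromBlocks₂₂, add_zero, zero_add] at h
  -- `1 = -1` in `Matrix (Fin n) (Fin n) 𝔸_L`: read the `(0,0)` entry
  have h00 := congrFun (congrFun h ⟨0, hn⟩) ⟨0, hn⟩
  simp only [Matrix.one_apply_eq, Matrix.neg_apply] at h00
  have h2 : (2 : AdeleRing (𝓞 L) L) = 0 := by linear_combination h00
  have hinj := AdeleRing.algebraMap_injective (𝓞 L) L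
  have : (2 : L) = 0 := hinj (by rw [map_ofNat, map_zero, h2])
  exact two_ne_zero this

/-- **`w_Δ u ∉ P_Δ(𝔸)` for `u ∈ N_Δ(𝔸)`** (`0 < n`): else `w_Δ = (w_Δ u) u⁻¹ ∈ P_Δ(𝔸)` as `N_Δ ≤ P_Δ`.  So no translate `P_Δ w_Δ ν` is the identity
coset: the `w_Δ`-orbit and the identity orbit of the right `N_Δ`-action on `P_Δ\H` are distinct. [cite: MoeglinWaldspurger1995, II.1.7] -/
theorem not_isSiegelDelta_weylDelta_mul (hn : 0 < n) {u : HA L e dV hdV dW hdW} (hu : u ∈ unipDelta L e dV hdV dW hdW) :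
    ¬ IsSiegelDelta L e dV hdV dW hdW (weylDelta L e dV hdV dW hdW * u) := by
  intro h
  have hu' : IsSiegelDelta L e dV hdV dW hdW u⁻¹ := isSiegelDelta_of_mem_unipDelta L e dV hdV dW hdW (inv_mem hu)
  have hw : IsSiegelDelta L e dV hdV dW hdW (weylDelta L e dV hdV dW hdW * u * u⁻¹) := isSiegelDelta_mul L e dV hdV dW hdW h hu'
  rw [mul_inv_cancel_right] at hw
  exact not_isSiegelDelta_weylDelta L e dV hdV dW hdW hn hw

/-- Coset form: there is no `p ∈ P_Δ(𝔸)` with `p · w_Δ u = 1`-translate, i.e. `p * (w_Δ * u) ∉ N_Δ(𝔸)·P_Δ(𝔸) = P_Δ(𝔸)` — stated as: `p * (w_Δ * u)` is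
never Siegel for `p` Siegel (`0 < n`, `u ∈ N_Δ(𝔸)`). [cite: MoeglinWaldspurger1995, II.1.7] -/
theorem not_isSiegelDelta_mul_weylDelta_mul (hn : 0 < n) {p u : HA L e dV hdV dW hdW} (hp : IsSiegelDelta L e dV hdV dW hdW p)
    (hu : u ∈ unipDelta L e dV hdV dW hdW) : ¬ IsSiegelDelta L e dV hdV dW hdW (p * (weylDelta L e dV hdV dW hdW * u)) := by
  intro h
  have hp' : IsSiegelDelta L e dV hdV dW hdW p⁻¹ := isSiegelDelta_inv L e dV hdV dW hdW hp
  have hw : IsSiegelDelta L e dV hdV dW hdW (p⁻¹ * (p * (weylDelta L e dV hdV dW hdW * u))) := isSiegelDelta_mul L e dV hdV dW hdW hp' h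
  rw [inv_mul_cancel_left] at hw
  exact not_isSiegelDelta_weylDelta_mul L e dV hdV dW hdW hn hu hw

end Summit.HodgeConjecture.HodgeConjecture.Cruxes.HLiu418.K2LiuSiegelBigCellFree

end
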